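import Summits.MatrixMultiplication.MatrixMultiplication.Theorems.SoloInformedValInducedMatching

/-!
# SoloInformedValHubPairFamily — hub-sharing block pairs of density tending to one

Solo-informed programme (MatrixMultiplication, side question on the value of trapezoid-free triples), gen 80;
dossier `paper/val-superlinear.md` §15.8 (l)–(m).

Setting (as in `SoloInformedValInducedMatching`): an abelian group `G`, potentials `x : I → G`, `y : J → G`,
`z : K → G`, pair graphs `H_IJ, H_JK, H_KI`, the hypothesis `NoAccidental` (no accidental solutions), and the
set of triangles `triangleSet H_IJ H_JK H_KI` (its size is the value `T` of the configuration).

A HUB PAIR is a configuration whose triangles are two complete blocks `X₁ × Y₁ × Z₁` and `X₂ × Y₂ × Z₂` with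
`X₁ ∩ X₂ = {hub}`, `Y₁ ∩ Y₂ = ∅ = Z₁ ∩ Z₂`.  The searches of gen 79 (all shape pairs with small sides, cyclic
orders `≤ 31`) suggested the "two-thirds law" `v₁ + v₂ ≤ 2|G|/3` for the volumes `v_s = |X_s| |Y_s| |Z_s|`
(dossier (15.8)(l), conjecture (U10); its fan case `|Y_s| = |Z_s| = 1` is the theorem
`NoAccidental.three_mul_card_fans_le` of `SoloInformedValFanPacking`).

## Result: the law is false — an explicit family of density `→ 1`

For all `q ≥ 1`, `r ≥ 0` put `s = 2r + 2` and `n = 2qr + 2q + r + 3 = (q - 1)s + 3r + 5`.  In `ℤ/n` take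

* `I = {hub, i₁, i₂}` with potentials `0, -(r+2), -1`;
* `J = {j_0, …, j_{q-1}} ∪ {j_∞}` with potentials `y(j_k) = k s` and `y(j_∞) = -(r+2)`;
* `K = {k_0, …, k_{r-1}} ∪ {k_∞}` with potentials `z(k_t) = t` and `z(k_∞) = r`;
* block 1 `= {hub, i₁} × {j_0..j_{q-1}} × {k_0..k_{r-1}}` (volume `2qr`), block 2 `= {hub, i₂} × {j_∞} × {k_∞}`
  (volume `2`), and `H_IJ, H_JK, H_KI` = the unions of the corresponding faces of the two blocks.

`famNoAccidental` : this configuration has NO ACCIDENTAL SOLUTIONS, for every `n` with `y(j_k) + 3r + 5 ≤ n`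
for all `k` — and more generally for ANY block-1 potentials `y(j_0) < y(j_1) < …` that are natural numbers with
gaps `≥ 2r + 2` (`famNoAccidental` is stated for such a `yv : Fin q → ℕ`; `famNoAccidental_ap` is the
arithmetic-progression instance in `ℤ/(2qr + 2q + r + 3)`).
`fam_card_triangleSet` : its triangles are exactly the two blocks, `T = 2qr + 2`.

PROOF.  The `KI`-labels `z - x` form the interval `[0, 2r+1]`, each value arising from exactly one edge; the
`JK`-labels are the "bricks" `[y(j_k) - r + 1, y(j_k)]` and the point `-(2r+2)`; the `IJ`-labels are `-y(j_k)`,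
`-y(j_k) - (r+2)` and `r+1, r+2`.  All potentials lie in a window of width `< n`, so a vanishing sum in `ℤ/n` of
an `IJ`-, a `JK`- and a `KI`-label vanishes in `ℤ` (`famSum_eq_zero`), i.e. `a + b ∈ [-(2r+1), 0]`; the window
`[-(2r+1), 0]` is tiled exactly by the trivial sums (brick `k` against the anchors `-y(j_k)` and
`-y(j_k) - (r+2)`, the point `-(2r+2)` against `r+1, r+2`), and the gap hypothesis keeps every other anchor/brick
combination outside it (`famInt_core`, linear arithmetic).

CONSEQUENCES (recorded in the dossier).  `(v₁ + v₂)/|G| = (2qr+2)/(2qr+2q+r+3) → 1`: there is no law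
`v₁ + v₂ ≤ c|G|` with `c < 1` for hub pairs; the two-thirds law fails as soon as `q(r-2) > r` — first at
`(q, r) = (2, 5)`, `|G| = 32`, volumes `20 + 2 = 22 > 64/3` (`fam_refutes_twoThirds_law`), and at `(3,4)` in `ℤ/37`
(`26 > 74/3`), `(4,4)` in `ℤ/47`, … .  For one-row blocks (`|X_s| = 1`, "stars") the law fails even more simply:
`K_{m,m} ⊔ K_{1,1}` inside a near-perfect pair, e.g. `{0,1,2,3} × {0,5,10,15} ∪ {4} × {20}` in `ℤ/24`
(`17 > 16`; `star24_noAccidental`, by `decide`).  What survives of (U10) is the census fact that no hub pair with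
all sides `≥ 2` and `v₁ + v₂ > |G|` exists in an abelian group of order `≤ 31` (dossier (15.8)(l)).
Elementary; no `sorry`.
-/

namespace Summit.MatrixMultiplication.MatrixMultiplication.Theorems.SoloVal

open Finset

section Family

variable {q r : ℕ}

/-- Integer `I`-potentials: hub `0 ↦ 0`, second row of block 1 `1 ↦ -(r+2)`, second row of block 2 `2 ↦ -1`. -/
def famXI (r : ℕ) (i : Fin 3) : ℤ :=
  if i = 0 then 0 else if i = 1 then -((r : ℤ) + 2) else -1

/-- Integer `J`-potentials: block 1 `some k ↦ yv k`, block 2 `none ↦ -(r+2)`. -/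
def famYI (r : ℕ) (yv : Fin q → ℕ) : Option (Fin q) → ℤ
  | none => -((r : ℤ) + 2)
  | some k => ((yv k : ℕ) : ℤ)

/-- Integer `K`-potentials: block 1 `some t ↦ t`, block 2 `none ↦ r`. -/
def famZI (r : ℕ) : Option (Fin r) → ℤ
  | none => (r : ℤ)
  | some t => ((t : ℕ) : ℤ)

/-- `H_IJ`: `{hub, i₁} × (block-1 J-vertices) ∪ {hub, i₂} × {j_∞}`. -/
def famHIJ (q : ℕ) : Finset (Fin 3 × Option (Fin q)) :=
  univ.filter (fun p => (p.2.isSome = true ∧ p.1 ≠ 2) ∨ (p.2 = none ∧ p.1 ≠ 1))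

/-- `H_JK`: (block-1 J-vertices) × (block-1 K-vertices) ∪ {(j_∞, k_∞)}. -/
def famHJK (q r : ℕ) : Finset (Option (Fin q) × Option (Fin r)) :=
  univ.filter (fun p => (p.1.isSome = true ∧ p.2.isSome = true) ∨ (p.1 = none ∧ p.2 = none))

/-- `H_KI`: (block-1 K-vertices) × {hub, i₁} ∪ {k_∞} × {hub, i₂}. -/
def famHKI (r : ℕ) : Finset (Option (Fin r) × Fin 3) :=
  univ.filter (fun p => (p.1.isSome = true ∧ p.2 ≠ 2) ∨ (p.1 = none ∧ p.2 ≠ 1))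

/-- Membership in `famHIJ`. -/
theorem mem_famHIJ {p : Fin 3 × Option (Fin q)} :
    p ∈ famHIJ q ↔ (p.2.isSome = true ∧ p.1 ≠ 2) ∨ (p.2 = none ∧ p.1 ≠ 1) := by
  simp [famHIJ]

/-- Membership in `famHJK`. -/
theorem mem_famHJK {p : Option (Fin q) × Option (Fin r)} :
    p ∈ famHJK q r ↔ (p.1.isSome = true ∧ p.2.isSome = true) ∨ (p.1 = none ∧ p.2 = none) := by
  simp [famHJK]

/-- Membership in `famHKI`. -/
theorem mem_famHKI {p : Option (Fin r) × Fin 3} :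
    p ∈ famHKI r ↔ (p.1.isSome = true ∧ p.2 ≠ 2) ∨ (p.1 = none ∧ p.2 ≠ 1) := by
  simp [famHKI]

/-- INTEGER CORE.  If the block-1 `J`-potentials increase with gaps `≥ 2r+2`, then a sum of an `IJ`-, a `JK`-
and a `KI`-label along edges that vanishes IN `ℤ` has matching indices. -/
theorem famInt_core (yv : Fin q → ℕ) (hsep : ∀ k k' : Fin q, k < k' → yv k + (2 * r + 2) ≤ yv k')
    {i i' : Fin 3} {j j' : Option (Fin q)} {k k' : Option (Fin r)}
    (hij : (i, j) ∈ famHIJ q) (hjk : (j', k) ∈ famHJK q r) (hki : (k', i') ∈ famHKI r)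
    (hsum : (famXI r i - famYI r yv j) + (famYI r yv j' - famZI r k) + (famZI r k' - famXI r i') = 0) :
    i = i' ∧ j = j' ∧ k = k' := by
  rw [mem_famHIJ] at hij
  rw [mem_famHJK] at hjk
  rw [mem_famHKI] at hki
  simp only at hij hjk hki
  rcases j with _ | k₁ <;> rcases j' with _ | k₁'
  · -- j = j' = j_∞ : then k = k_∞, the anchor is r+2 (hub) or r+1 (i₂)
    rcases k with _ | t
    · rcases k' with _ | t'
      · (fin_cases i <;> fin_cases i' <;> simp [famXI, famYI, famZI] at hij hki hsum ⊢); omega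
      · have ht' := t'.2
        fin_cases i <;> fin_cases i' <;> simp [famXI, famYI, famZI] at hij hki hsum ⊢ <;> omega
    · simp at hjk
  · -- j = j_∞, j' = j_{k₁'} : anchor ≥ r+1, brick ≥ -(r-1), so the sum is positive
    exfalso
    rcases k with _ | t
    · simp at hjk
    · have ht := t.2
      rcases k' with _ | t'
      · fin_cases i <;> fin_cases i' <;> simp [famXI, famYI, famZI] at hij hki hsum ⊢ <;> omega
      · have ht' := t'.2
        fin_cases i <;> fin_cases i' <;> simp [famXI, famYI, famZI] at hij hki hsum ⊢ <;> omega
  · -- j = j_{k₁}, j' = j_∞ : brick is the point -(2r+2), anchor ≤ 0, label sum < 0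
    exfalso
    rcases k with _ | t
    · rcases k' with _ | t'
      · fin_cases i <;> fin_cases i' <;> simp [famXI, famYI, famZI] at hij hki hsum ⊢ <;> omega
      · have ht' := t'.2
        fin_cases i <;> fin_cases i' <;> simp [famXI, famYI, famZI] at hij hki hsum ⊢ <;> omega
    · simp at hjk
  · -- both in block 1: equal indices are forced by the window, distinct ones excluded by the gaps
    rcases k with _ | t
    · simp at hjk
    · have ht := t.2
      have hgap : yv k₁ = yv k₁' ∧ k₁ = k₁' ∨ yv k₁ + (2 * r + 2) ≤ yv k₁' ∨ yv k₁' + (2 * r + 2) ≤ yv k₁ := by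
        rcases lt_trichotomy k₁ k₁' with h | h | h
        · exact Or.inr (Or.inl (hsep k₁ k₁' h))
        · exact Or.inl ⟨by rw [h], h⟩
        · exact Or.inr (Or.inr (hsep k₁' k₁ h))
      rcases k' with _ | t'
      · rcases hgap with ⟨hy, hk⟩ | hy | hy <;>
          fin_cases i <;> fin_cases i' <;> simp [famXI, famYI, famZI] at hij hki hsum ⊢ <;> omega
      · have ht' := t'.2
        rcases hgap with ⟨hy, hk⟩ | hy | hy
        · subst hk
          fin_cases i <;> fin_cases i' <;> simp [famXI, famYI, famZI, Fin.ext_iff] at hij hki hsum ⊢ <;> omega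
        · fin_cases i <;> fin_cases i' <;> simp [famXI, famYI, famZI] at hij hki hsum ⊢ <;> omega
        · fin_cases i <;> fin_cases i' <;> simp [famXI, famYI, famZI] at hij hki hsum ⊢ <;> omega

/-- Bounds of the integer `I`-potentials. -/
theorem famXI_bound (i : Fin 3) : -((r : ℤ) + 2) ≤ famXI r i ∧ famXI r i ≤ 0 := by
  unfold famXI
  split_ifs <;> constructor <;> omega

/-- Bounds of the integer `J`-potentials. -/
theorem famYI_bound (yv : Fin q → ℕ) {n : ℕ} (htop : ∀ k, yv k + 3 * r + 5 ≤ n) (hn : 3 * r + 5 ≤ n)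
    (j : Option (Fin q)) : -((r : ℤ) + 2) ≤ famYI r yv j ∧ famYI r yv j + 3 * r + 5 ≤ n := by
  rcases j with _ | k
  · simp only [famYI]
    omega
  · have := htop k
    simp only [famYI]
    omega

/-- Bounds of the integer `K`-potentials. -/
theorem famZI_bound (k : Option (Fin r)) : 0 ≤ famZI r k ∧ famZI r k ≤ r := by
  rcases k with _ | t
  · simp only [famZI]
    omega
  · have := t.2
    simp only [famZI]
    omega

/-- NO WRAP-AROUND.  With all block-1 `J`-potentials `≤ n - 3r - 5`, a label sum that vanishes in `ℤ/n`
vanishes in `ℤ`. -/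
theorem famSum_eq_zero (yv : Fin q → ℕ) {n : ℕ} (htop : ∀ k, yv k + 3 * r + 5 ≤ n) (hn : 3 * r + 5 ≤ n)
    (i i' : Fin 3) (j j' : Option (Fin q)) (k k' : Option (Fin r))
    (hsum : (((famXI r i - famYI r yv j) + (famYI r yv j' - famZI r k) + (famZI r k' - famXI r i') : ℤ) :
      ZMod n) = 0) :
    (famXI r i - famYI r yv j) + (famYI r yv j' - famZI r k) + (famZI r k' - famXI r i') = 0 := by
  have hdvd := (ZMod.intCast_zmod_eq_zero_iff_dvd _ n).mp hsum
  have h1 := famXI_bound (r := r) i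
  have h2 := famXI_bound (r := r) i'
  have h3 := famYI_bound yv htop hn j
  have h4 := famYI_bound yv htop hn j'
  have h5 := famZI_bound (r := r) k
  have h6 := famZI_bound (r := r) k'
  refine Int.eq_zero_of_abs_lt_dvd hdvd (abs_lt.mpr ⟨?_, ?_⟩) <;> omega

/-- The potentials of the family in `ℤ/n`. -/
def famX (r n : ℕ) (i : Fin 3) : ZMod n := (famXI r i : ZMod n)

/-- See `famX`. -/
def famY (r n : ℕ) (yv : Fin q → ℕ) (j : Option (Fin q)) : ZMod n := (famYI r yv j : ZMod n)

/-- See `famX`. -/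
def famZ (r n : ℕ) (k : Option (Fin r)) : ZMod n := (famZI r k : ZMod n)

/-- THE FAMILY HAS NO ACCIDENTAL SOLUTIONS (general gapped version): block-1 `J`-potentials `yv` increasing with
gaps `≥ 2r + 2` and `yv k + 3r + 5 ≤ n`. -/
theorem famNoAccidental (yv : Fin q → ℕ) {n : ℕ}
    (hsep : ∀ k k' : Fin q, k < k' → yv k + (2 * r + 2) ≤ yv k')
    (htop : ∀ k, yv k + 3 * r + 5 ≤ n) (hn : 3 * r + 5 ≤ n) :
    NoAccidental (famX r n) (famY r n yv) (famZ r n) (famHIJ q) (famHJK q r) (famHKI r) := by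
  intro i j j' k k' i' hij hjk hki hsum
  refine famInt_core yv hsep hij hjk hki (famSum_eq_zero yv htop hn i i' j j' k k' ?_)
  simpa [famX, famY, famZ] using hsum

/-- The arithmetic-progression choice `y(j_k) = (2r+2) k`. -/
def famAP (r q : ℕ) (k : Fin q) : ℕ := (2 * r + 2) * k

/-- The arithmetic progression has gaps `2r + 2`. -/
theorem famAP_sep (k k' : Fin q) (h : k < k') : famAP r q k + (2 * r + 2) ≤ famAP r q k' := by
  unfold famAP
  have h' : (k : ℕ) + 1 ≤ k' := h
  calc (2 * r + 2) * (k : ℕ) + (2 * r + 2) = (2 * r + 2) * ((k : ℕ) + 1) := by ring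
    _ ≤ (2 * r + 2) * (k' : ℕ) := Nat.mul_le_mul_left _ h'

/-- The arithmetic progression fits: `(2r+2) k + 3r + 5 ≤ 2qr + 2q + r + 3` for `k < q`. -/
theorem famAP_top (k : Fin q) : famAP r q k + 3 * r + 5 ≤ 2 * q * r + 2 * q + r + 3 := by
  unfold famAP
  have hk : (k : ℕ) + 1 ≤ q := k.2
  have : (2 * r + 2) * (k : ℕ) + (2 * r + 2) ≤ (2 * r + 2) * q := by
    calc (2 * r + 2) * (k : ℕ) + (2 * r + 2) = (2 * r + 2) * ((k : ℕ) + 1) := by ring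
      _ ≤ (2 * r + 2) * q := Nat.mul_le_mul_left _ hk
  nlinarith

/-- THE FAMILY `F(q, r)` IN `ℤ/(2qr + 2q + r + 3)` HAS NO ACCIDENTAL SOLUTIONS (all `q ≥ 1`, all `r`). -/
theorem famNoAccidental_ap (q r : ℕ) (hq : 1 ≤ q) :
    NoAccidental (famX r (2 * q * r + 2 * q + r + 3)) (famY r (2 * q * r + 2 * q + r + 3) (famAP r q))
      (famZ r (2 * q * r + 2 * q + r + 3)) (famHIJ q) (famHJK q r) (famHKI r) := by
  have h1 : r ≤ q * r := Nat.le_mul_of_pos_left r hq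
  exact famNoAccidental (famAP r q) (fun k k' h => famAP_sep k k' h) (fun k => famAP_top k) (by nlinarith [h1])

/-! ### The triangles of the family are the two blocks: `T = 2qr + 2` -/

/-- Block 1 as a set of triples: `{hub, i₁} × (block-1 J-vertices) × (block-1 K-vertices)`. -/
def famBlock1 (q r : ℕ) : Finset (Fin 3 × Option (Fin q) × Option (Fin r)) :=
  ({0, 1} : Finset (Fin 3)) ×ˢ ((univ.image some) ×ˢ (univ.image some))

/-- Block 2: `{hub, i₂} × {j_∞} × {k_∞}`. -/
def famBlock2 (q r : ℕ) : Finset (Fin 3 × Option (Fin q) × Option (Fin r)) :=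
  ({0, 2} : Finset (Fin 3)) ×ˢ (({none} : Finset (Option (Fin q))) ×ˢ ({none} : Finset (Option (Fin r))))

/-- `|block 1| = 2qr`. -/
theorem famBlock1_card : (famBlock1 q r).card = 2 * q * r := by
  unfold famBlock1
  rw [card_product, card_product, card_image_of_injective _ (Option.some_injective _),
    card_image_of_injective _ (Option.some_injective _), card_univ, card_univ, Fintype.card_fin,
    Fintype.card_fin]
  simp [mul_assoc]

/-- `|block 2| = 2`. -/
theorem famBlock2_card : (famBlock2 q r).card = 2 := by
  unfold famBlock2
  rw [card_product, card_product]
  simp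

/-- The two blocks are disjoint. -/
theorem famBlocks_disjoint : Disjoint (famBlock1 q r) (famBlock2 q r) := by
  rw [Finset.disjoint_left]
  rintro ⟨i, j, k⟩ h1 h2
  have hj1 : j ∈ (univ : Finset (Fin q)).image some := (mem_product.mp (mem_product.mp h1).2).1
  have hj2 : j ∈ ({none} : Finset (Option (Fin q))) := (mem_product.mp (mem_product.mp h2).2).1
  rw [mem_singleton] at hj2
  obtain ⟨a, -, ha⟩ := mem_image.mp hj1
  rw [hj2] at ha
  exact Option.some_ne_none a ha

/-- The triangle set of the family is the disjoint union of the two blocks. -/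
theorem fam_triangleSet_eq : triangleSet (famHIJ q) (famHJK q r) (famHKI r) = famBlock1 q r ∪ famBlock2 q r := by
  ext ⟨i, j, k⟩
  rw [mem_triangleSet, mem_union]
  unfold IsTriangle
  rw [mem_famHIJ, mem_famHJK, mem_famHKI]
  simp only [famBlock1, famBlock2, mem_product, mem_insert, mem_singleton, mem_image, mem_univ, true_and]
  rcases j with _ | a <;> rcases k with _ | b <;> fin_cases i <;> simp

/-- `T = 2qr + 2`. -/
theorem fam_card_triangleSet : (triangleSet (famHIJ q) (famHJK q r) (famHKI r)).card = 2 * q * r + 2 := by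
  rw [fam_triangleSet_eq, card_union_of_disjoint famBlocks_disjoint, famBlock1_card, famBlock2_card]

/-- REFUTATION OF THE TWO-THIRDS LAW (smallest member of the family that beats it): `q = 2`, `r = 5`,
`|G| = 32`, an accidental-free hub pair with `T = 22` triangles, `3 · 22 = 66 > 64 = 2 · 32`. -/
theorem fam_refutes_twoThirds_law :
    NoAccidental (famX 5 32) (famY 5 32 (famAP 5 2)) (famZ 5 32) (famHIJ 2) (famHJK 2 5) (famHKI 5) ∧
    2 * Fintype.card (ZMod 32) < 3 * (triangleSet (famHIJ 2) (famHJK 2 5) (famHKI 5)).card := by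
  refine ⟨famNoAccidental_ap 2 5 (by norm_num), ?_⟩
  rw [fam_card_triangleSet, ZMod.card]
  norm_num

/-- DENSITY TENDING TO ONE: for every `q ≥ 1` and every `r` the family gives an accidental-free hub pair with
`T = 2qr + 2` triangles in a group of order `2qr + 2q + r + 3`. -/
theorem fam_density (q r : ℕ) (hq : 1 ≤ q) :
    NoAccidental (famX r (2 * q * r + 2 * q + r + 3)) (famY r (2 * q * r + 2 * q + r + 3) (famAP r q))
      (famZ r (2 * q * r + 2 * q + r + 3)) (famHIJ q) (famHJK q r) (famHKI r) ∧
    (triangleSet (famHIJ q) (famHJK q r) (famHKI r)).card = 2 * q * r + 2 ∧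
    Fintype.card (ZMod (2 * q * r + 2 * q + r + 3)) = 2 * q * r + 2 * q + r + 3 :=
  ⟨famNoAccidental_ap q r hq, fam_card_triangleSet, ZMod.card _⟩

end Family

/-! ### One-row blocks: `K_{4,4} ⊔ K_{1,1}` in `ℤ/24` -/

section Star

/-- The single `I`-vertex (hub), potential `0`. -/
def starX : Fin 1 → ZMod 24 := fun _ => 0

/-- `J`-potentials `0, 1, 2, 3, 4`. -/
def starY : Fin 5 → ZMod 24 := fun j => ((j : ℕ) : ZMod 24)

/-- `K`-potentials `0, 5, 10, 15, 20`. -/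
def starZ : Fin 5 → ZMod 24 := fun k => ((5 * (k : ℕ) : ℕ) : ZMod 24)

/-- `H_IJ = {hub} × J`. -/
def starHIJ : Finset (Fin 1 × Fin 5) := univ

/-- `H_JK = {0,1,2,3} × {0,1,2,3} ∪ {(4, 4)}` (`K_{4,4} ⊔ K_{1,1}`). -/
def starHJK : Finset (Fin 5 × Fin 5) := univ.filter (fun p => (p.1 ≠ 4 ∧ p.2 ≠ 4) ∨ (p.1 = 4 ∧ p.2 = 4))

/-- `H_KI = K × {hub}`. -/
def starHKI : Finset (Fin 5 × Fin 1) := univ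

/-- The one-row hub pair `{0} × {0,1,2,3} × {0,5,10,15} ∪ {0} × {4} × {20}` of `ℤ/24` has no accidental
solutions. -/
theorem star24_noAccidental : NoAccidental starX starY starZ starHIJ starHJK starHKI := by
  unfold NoAccidental starX starY starZ starHIJ starHJK starHKI
  decide

/-- … and `17` triangles: `3 · 17 = 51 > 48 = 2 · 24` (indeed `17 > 16 = 2|G|/3`). -/
theorem star24_card : (triangleSet starHIJ starHJK starHKI).card = 17 ∧
    2 * Fintype.card (ZMod 24) < 3 * (triangleSet starHIJ starHJK starHKI).card := by
  have h : (triangleSet starHIJ starHJK starHKI).card = 17 := by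
    unfold triangleSet starHIJ starHJK starHKI
    decide
  refine ⟨h, ?_⟩
  rw [h, ZMod.card]
  norm_num

end Star

end Summit.MatrixMultiplication.MatrixMultiplication.Theorems.SoloVal
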